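import Literature.MathematicalPhysics.QuantumFieldTheory.OSWightmanVectors
import Literature.MathematicalPhysics.QuantumFieldTheory.OSLorentzInvariantOfTimeContinuation
import Literature.MathematicalPhysics.QuantumFieldTheory.OSPointAllOrders
import HarnessLib

/-!
# `os_reconstruction` from (A1) `OS1975_exists_timeContinuation` alone — the split, assembled

Topic `Literature/MathematicalPhysics/QuantumFieldTheory`; composition file (theorems only, no new
definitions, no new named facts) recording in ONE place the state of the decomposition of the
named fact `os_reconstruction` (file `Wightman`; Osterwalder–Schrader, CMP 42 (1975), §IV.1
Theorem E'→R') after the literature-prover units that hit the budget cap on it.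

The printed proof was decomposed in the tree as (A1) time continuation (OS II Thm. 4.3),
(A2) tempered boundary values with half-space spectral support, (B) Lorentz invariance of the
boundary values, (D) uniqueness on the time tube, and the Wightman properties R1–R5 with the
Wightman reconstruction theorem and uniqueness (`WightmanProofs`, `OSTimeContinuation`, …).
Every piece except (A1) is now a theorem of the tree:
`OS1975_boundaryValue_of_timeContinuation_holds` (A2), `OS1973_lorentzInvariant_of_timeContinuation_holds`
(B), `eqOn_timeTube_of_timeRayBoundaryValue_holds` (D), and
`os_reconstruction_of_exists_continuation_halfSpace` (everything downstream of the half-space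
continuation (A₁₂⁺), itself `OS1975_exists_continuation_halfSpace_of_A1`). Hence:

* `os_reconstruction_holds_of : OS1975_exists_timeContinuation → os_reconstruction` — the parent
  hinges on the single named fact (A1), Osterwalder–Schrader II Thm. 4.3 (Ch. V–VI);
* `os_reconstruction_of_sumBound` — and (A1) in turn on the sum-form temperedness estimate (4.5)
  of OS II Thm. 4.1 for the Schwinger function values (`HasPointSumBound`, proved in OS II
  Ch. VI.1 and not yet formalised; its min-gap form on the densities is
  `schwinger_exists_realAnalytic_density_tempered`, file `OSTemperedness`), by
  `OS1975_exists_timeContinuation_of_sumBound` (file `OSPointAllOrders`).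

## References

* [OsterwalderSchraderCMP1975] K. Osterwalder, R. Schrader, Axioms for Euclidean Green's
  functions II, Comm. Math. Phys. 42 (1975) 281–305, §IV.1 Thm. E'→R', §IV.2 Thms. 4.1–4.3,
  Ch. V–VI.
* [OsterwalderSchraderCMP1973] K. Osterwalder, R. Schrader, Axioms for Euclidean Green's
  functions, Comm. Math. Phys. 31 (1973) 83–112, §4.
-/

noncomputable section

namespace Literature.MathematicalPhysics.QuantumFieldTheory

open Literature.MathematicalPhysics.QuantumLattice (SchwingerFamily SpaceTime)
open Literature.MathematicalPhysics.QuantumLattice.SchwingerFamily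

/-- **`os_reconstruction` from (A1) alone.** Osterwalder–Schrader's Theorem E'→R' follows from
the time continuation (A1) `OS1975_exists_timeContinuation` (OS II Thm. 4.3): (A2), (B), (D) are
theorems (`OS1975_exists_continuation_halfSpace_of_A1`) and so is everything downstream of the
half-space continuation (`os_reconstruction_of_exists_continuation_halfSpace`: R1–R5,
hermiticity, Wightman reconstruction, uniqueness). Real proof (composition).
[cite: OsterwalderSchraderCMP1975, §IV.1 Thm. E'→R' and §IV.2 Thm. 4.3] -/
theorem os_reconstruction_holds_of (hA1 : OS1975_exists_timeContinuation) : os_reconstruction :=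
  os_reconstruction_of_exists_continuation_halfSpace
    (OS1975_exists_continuation_halfSpace_of_A1 hA1)

/-- **`os_reconstruction` from the sum-form temperedness estimate (4.5).** If every OS family
with E0' obeys the sum-form bound `HasPointSumBound` on its Schwinger function values (OS II
Thm. 4.1, estimate (4.5), proved in Ch. VI.1), then `os_reconstruction` holds:
`OS1975_exists_timeContinuation_of_sumBound` gives (A1), and `os_reconstruction_holds_of`
concludes. Real proof (composition). [cite: OsterwalderSchraderCMP1975, §IV.2 Thm. 4.1 (4.5) and Thm. 4.3] -/
theorem os_reconstruction_of_sumBound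
    (h : ∀ (d : ℕ) [NeZero d] (S : SchwingerFamily (SpaceTime d)) (hOS : S.IsOSFamily)
      (hE0 : S.HasLinearGrowth), ∃ (t : ℕ) (γ : ℝ) (m : ℕ) (α₀ : ℕ → ℝ),
        HasPointSumBound hOS.covariant hOS.reflectionPositive hE0 t γ m α₀) :
    os_reconstruction :=
  os_reconstruction_holds_of (OS1975_exists_timeContinuation_of_sumBound h)

end Literature.MathematicalPhysics.QuantumFieldTheory

end
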